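import Mathlib.Analysis.Complex.Basic
import Mathlib.LinearAlgebra.Dual.Defs
import Mathlib.LinearAlgebra.Span.Defs
import Mathlib.Topology.Algebra.Module.Basic
import HarnessLib

/-!
# Bouaziz (1994), §6 «Intégrales orbitales stables»: the stable orbital integral `J^st_G` (§6.2 (1)), the space `𝓘^st(𝒰)`,
# THÉORÈME 6.2.1 (i)–(iv) (p. 592) and REMARQUES 1–2 (pp. 593–594)

Topic `RepresentationTheory/Bouaziz1994`; namespace `Literature.RepresentationTheory.Bouaziz1994.OrbitalIntegralsCharacterisation`.
Carpet of the cell `hodgecm-mathlib`, squad TN «LN ∕ LS transfer», seat TN-t03 (g4), DEAL v12 row G17 (live sockets: LH2 `stub_N8bouaziz`,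
LH3 `stub_N9bouazizSchema`, books #94 ∕ #95).  STATEMENTS: `def`s with bodies, every printed assertion a `def … : Prop` PREDICATE on explicit
data (squad convention, as in ★ `Literature.NumberTheory.Rogawski1990.ArchBouazizReplacement` and ★ `Shelstad1979.StableOrbitalIntegrals`): nothing
is asserted for all data; **no `sorry`, no `axiom`, no `instance`, no `notation`**; two unfolding lemmas proved by `rfl`.
Source: A. Bouaziz, *Intégrales orbitales sur les groupes de Lie réductifs*, Ann. Sci. École Norm. Sup. (4) **27** (1994) 573–609
[Bouaziz1994IntegralesOrbitales] — HELD page-exact (`paper:doi-10-24033-asens-1701`, file `pNNNN` = printed page `NNNN + 571`; the NUMDAM scan is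
bilevel CCITT-G4 with an OCR layer that drops the displays: every display below was READ on the decoded page images
`run/shared/lean/pub/hodgecm-mathlib/T/LNS/TN-t03/g4/pages-Bouaziz1994/` — not reconstructed); pins «(p. N)» are the printed pages.

## Print (§3.1, §3.2, §6.2) and the dress

§3.1 (p. 579): «Si `A` est une partie de `G`, on note `𝒟(A)` l'espace des fonctions `C^∞` sur `G` à support compact inclus dans `A`»; for
`𝒰 ⊂ G` a completely invariant open set and `γ ∈ 𝒰_reg`, `J_G(φ)(γ) = |det(1 − Ad(γ⁻¹))_{𝔤∕𝔥}|^{1∕2} ∫_{G∕Z(G,γH⁰)} φ(gγg⁻¹) dġ` (the normalised orbital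
integral; `γ ↦ J_G(φ)(γ) ∈ C^∞(𝒰_reg)^G`).  §3.2 (pp. 579–581): `𝓘(𝒰)` = the functions `ψ ∈ C^∞(𝒰_reg)^G` with `I₁(G)`–`I₄(G)` (boundedness of
`∂(u)ψ_H` on compacts, smooth extension of `b_Ψ ψ_H` to `H_{In-reg} ∩ 𝒰`, Harish-Chandra's jump relations at the jump data `(s, H, Ψ, H′, Ψ′, c_α)`,
support compact modulo `G`); THÉORÈME 3.2.1: «`J_G : 𝒟(𝒰) → 𝓘(𝒰)` est surjective et sa transposée `ᵗJ_G` est une bijection de `𝓘(𝒰)′` sur l'espace des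
distributions `G`-invariantes sur `𝒰`».  §6.2 (p. 591): for `𝒰 ⊂ G` a STABLY completely invariant open set, `f ∈ 𝒟(𝒰)`, `γ ∈ 𝒰_reg`, `𝐓` the Cartan
subgroup of `𝐆` through `γ`, `T = 𝐓 ∩ G`:
  (1) `J^st_G(f)(γ) = |W(G,T)|⁻¹ Σ_{w ∈ W(𝐆,T)} J_G(f)(w·γ)`
(«l'ensemble `⋃_{w ∈ W(𝐆,T)} G[w·γ]` n'est pas en général égal à l'orbite stable de `γ`, il est appelé dans [C] l'orbite superstable de `γ`»);
`𝓘^st(𝒰)` = the functions `C^∞` on `𝒰_reg`, stably invariant, with `I₁(G)`, `I₄(G)`, `I₂^st(G)` (`T_{In-reg}` replaced by `T^st_{In-reg}` = the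
`x ∈ T_{In-reg}` whose `W(𝐆,T)`-orbit lies in `T_{In-reg}`) and `I₃^st(G)` (the factor `d(α)` replaced by `2`); «Alors la fonction `J^st_G(f)` appartient à
`𝓘^st(𝒰)` … pour `I^st_3(G)` voir [S-1], lemme 4.3» ([S-1] = [Shelstad1979] = ★ `Shelstad1979.StableOrbitalIntegrals`, whose `Shelstad1979_4_7_*`
conditions are the Schwartz-space form of the same jump data); `𝓘^st_j(𝒰)` = the `ψ ∈ 𝓘^st(𝒰)` with `ψ_T ≡ 0` for `T ∈ Car_k(G)`, `k > j`;
`Π^st_j(ψ) = Σ_{1≤i≤k} b_{Ψ_i} ψ_{T_i}` on representatives `T_1, …, T_k` of `Car_j(G)∕G` with values in `⊕_i 𝒟(𝒰 ∩ T_i)^{Ψ_i,st}` (the functions with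
`(*) f(g⁻¹tg) = ε_I(g) ξ_{ρ_Ψ − g·ρ_Ψ} f(t)`, `g ∈ N(𝐆, 𝔱)`).  p. 592: «une distribution sur `𝒰` est dite stablement invariante si elle se trouve dans la
clôture pour la topologie faible de l'espace vectoriel engendré par les distributions `f ↦ J^st_G(f)(γ)`, `γ ∈ 𝒰_reg`».

DRESS (explicit data, nothing asserted).  FUNCTION DRESS (§1–§3, the consumer-facing statements): the group of real points is a type `G`;
`Ureg : Set G` is `𝒰_reg`; the function spaces `𝒟(𝒰)`, `𝓘(𝒰)`, `𝓘^st(𝒰)`, `𝓘^st_j(𝒰)`, `𝒟(𝒰 ∩ T_i)^{Ψ_i,st}` are PREDICATES on functions (parameters — the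
tree has neither `C_c^∞` of a real reductive group nor the jump conditions `I₁–I₄` as checkable predicates; ★ `Shelstad1979.StableOrbitalIntegrals` types
Shelstad's family version of `(I)–(IIIb)` in the same way); the normalised orbital integral `J_G` is a DATUM `J : (G → ℂ) → (G → ℂ)` (Haar measures on
`G∕Z(G, γH⁰)` are not in the tree); the superstable orbit `{w·γ : w ∈ W(𝐆,T)} ⊂ T` is a datum `orb : G → Finset G` and `|W(G,T_γ)|` a datum
`nW : G → ℕ` — so that the objects print DEFINES, `J^st_G` (display (1)), `ψ^st` (Remarque 1) and `Π^st_j`, get their PRINTED BODIES (`superstableAverage`,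
`bouazizJst`, `stabilise`, `piSt`).  DUAL DRESS (§4, assertions (ii), (iv) about distributions): `𝒟(𝒰)`, `𝓘^st(𝒰)`, `𝓘^st_j(𝒰)`, the direct sum are abstract
`ℂ`-modules, the continuous duals (`𝒟(𝒰)′` = distributions on `𝒰`, `𝓘^st(𝒰)′`, …) are `Submodule`s of the algebraic duals given as PARAMETERS (the `LF`
topologies of p. 591 are not typed), evaluation at `γ ∈ 𝒰_reg` is a family of functionals `ev`, and «clôture pour la topologie faible» is the closure for the
topology of pointwise convergence on `𝒟(𝒰)` (`IsStablyInvariantDistribution`).  Equality of functions on `𝒰_reg` is stated pointwise on `Ureg`.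

CONSUMERS (census 2026-09-02): ★ `Rogawski1990.ArchBouazizReplacement` (the SCHEMA of [Shelstad2012, Cor. 2.2, proof] = Thm. 6.2.1 (i) + Rem. 2 applied
to a Schwartz `f₁⁰` with boundedly supported stable orbital integrals; instances `stub_N8bouaziz`, `stub_N9bouazizSchema`), ★ `Rogawski1990.ArchInnerTransferOfSchwartzReplacement`,
★ `Automorphic.ArchSchwartzSpace`, ★ `Arthur2013.Leaves.InvariantTraceFormula` — all cite «Thm. 6.2.1 (i) p. 592; Rem. 2 p. 594» bare.  They can now cite
`Bouaziz1994_6_2_1_i_surjective` (surjectivity of `J^st_G` onto `𝓘^st(𝒰)`) and `Bouaziz1994_6_Rem2_testFunctionTransfer` («si `φ ∈ 𝒟(G)`, on peut prendre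
`φ_H` dans `𝒟(H)`») BY NAME; the passage from their ★ `stableOrbitalIntegralRel` (sum over the stable class, un-normalised) to print's `J^st_G` (display (1):
`|W(G,T)|⁻¹` × sum over the SUPERSTABLE orbit of the `|det(1 − Ad γ⁻¹)|^{1∕2}`-normalised integrals) is a non-vanishing factor on `𝒰_reg` and a change of the
indexing set, which is THEIR bookkeeping (flagged, not typed here).

## Census (print item ↦ declaration)

| print | declaration | kind |
|---|---|---|
| §6.2 (1) `J^st_G(f)(γ) = |W(G,T)|⁻¹ Σ_{w ∈ W(𝐆,T)} J_G(f)(w·γ)` (p. 591) | `superstableAverage`, `bouazizJst` | def (body = (1)) |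
| §6.2 «`J^st_G(f) ∈ 𝓘^st(𝒰)`» (p. 591) | `Bouaziz1994_6_2_jst_mem` | def (Prop), predicate |
| §6.2 `Π^st_j(ψ) = Σ_i b_{Ψ_i} ψ_{T_i}` (p. 591) | `piSt` | def (body) |
| p. 592 «distribution stablement invariante» | `IsStablyInvariantDistribution` (dual dress) | def (Prop) |
| THM 6.2.1 (i) (p. 592) | `Bouaziz1994_6_2_1_i_surjective` | def (Prop), predicate |
| THM 6.2.1 (ii) (p. 592) | `Bouaziz1994_6_2_1_ii_transpose` (dual dress) | def (Prop), predicate |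
| THM 6.2.1 (iii) (p. 592) | `Bouaziz1994_6_2_1_iii_piSt_surjective` | def (Prop), predicate |
| THM 6.2.1 (iv) (p. 592) | `Bouaziz1994_6_2_1_iv_transpose` (dual dress) | def (Prop), predicate |
| REMARQUE 1 `ψ^st(γ) = |W(G,T)|⁻¹ Σ_{w ∈ W(𝐆,T)} ψ(w·γ)`; «`ψ^st ∈ 𝓘^st(𝒰)` … `ψ ↦ ψ^st` … est surjective» (pp. 593–594) | `stabilise`, `Bouaziz1994_6_Rem1_stabilise` | def, def (Prop) |
| REMARQUE 2 «si `φ ∈ 𝒟(G)`, on peut prendre `φ_H` dans `𝒟(H)`» (p. 594) | `Bouaziz1994_6_Rem2_testFunctionTransfer` | def (Prop), predicate |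
| REMARQUE 2 «relèvement» `Rel(Θ)(φ) = Θ(φ_H)` (p. 594) | `Bouaziz1994_6_Rem2_relevement` | def (Prop), predicate |
| LEMME 6.1.1 (partition of unity by stably invariant `C^∞` functions, p. 590) | not typed — a statement about compacts modulo `G` and stably completely invariant open covers with no consumer; in this dress it would be a predicate over five opaque classes | — |
| §6.3 LEMME 6.3.1, THÉORÈME 6.3.2 (inner forms, pp. 594–596) | not dealt (DEAL v12 = Thm. 6.2.1 + Rem. 2) | — |

DEDUP (2026-09-02): `ls lean/Literature/RepresentationTheory lean/Literature/NumberTheory/Automorphic | rg -i bouaziz` = none; `rg 'Bouaziz1994'` = the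
five consumers above (schema ∕ prose), no statement of §6 typed anywhere; ★ `Shelstad1979.StableOrbitalIntegrals.shelstadStableSum` is Shelstad's `Φ¹_f`
(sum over `𝒟(T)`, Schwartz functions) — a sibling with a different indexing and normalisation, cited not reused.
-/

noncomputable section

open scoped BigOperators
open Topology

namespace Literature.RepresentationTheory.Bouaziz1994.OrbitalIntegralsCharacterisation

/-! ## §1. §6.2 display (1): the stable orbital integral `J^st_G`, and Remarque 1's `ψ ↦ ψ^st` (pp. 591, 593) -/

section FunctionDress

variable {G : Type*}

/-- The SUPERSTABLE AVERAGE of a function `φ` on `𝒰_reg` (the common shape of §6.2 (1), p. 591, and of Remarque 1, p. 593):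
`γ ↦ |W(G,T)|⁻¹ Σ_{w ∈ W(𝐆,T)} φ(w·γ)`, `T = T_γ`.  Data: `orb γ` = the `W(𝐆,T)`-orbit `{w·γ}` of `γ` inside `T` (a `Finset`; for regular `γ` the map
`w ↦ w·γ` is injective, so print's sum over `W(𝐆,T)` is the sum over this set), `nW γ = |W(G,T_γ)|` (the real Weyl group).
[cite: Bouaziz1994IntegralesOrbitales, §6.2 (1) (p. 591); Remarque 1 (p. 593)] -/
def superstableAverage (orb : G → Finset G) (nW : G → ℕ) (φ : G → ℂ) (γ : G) : ℂ :=
  ((nW γ : ℂ))⁻¹ * ∑ δ ∈ orb γ, φ δ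

/-- **§6.2 (1), p. 591: `J^st_G(f)(γ) = |W(G,T)|⁻¹ Σ_{w ∈ W(𝐆,T)} J_G(f)(w·γ)`** — «l'intégrale orbitale stable de `f` en `γ ∈ 𝒰_reg`».  PRINTED BODY over the
datum `J` = the normalised orbital integral `J_G` of §3.1 (`J_G(φ)(γ) = |det(1 − Ad(γ⁻¹))_{𝔤∕𝔥}|^{1∕2} ∫_{G∕Z(G,γH⁰)} φ(gγg⁻¹)dġ`, p. 579 — its Haar-measure
body is not typed) and the superstable-orbit data `orb`, `nW` of `superstableAverage`. [cite: Bouaziz1994IntegralesOrbitales, §6.2 (1) (p. 591); §3.1 (p. 579)] -/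
def bouazizJst (J : (G → ℂ) → G → ℂ) (orb : G → Finset G) (nW : G → ℕ) (f : G → ℂ) : G → ℂ :=
  superstableAverage orb nW (J f)

/-- Unfolding of `bouazizJst` (display (1), p. 591). [cite: Bouaziz1994IntegralesOrbitales, §6.2 (1) (p. 591)] -/
theorem bouazizJst_apply (J : (G → ℂ) → G → ℂ) (orb : G → Finset G) (nW : G → ℕ) (f : G → ℂ) (γ : G) :
    bouazizJst J orb nW f γ = ((nW γ : ℂ))⁻¹ * ∑ δ ∈ orb γ, J f δ := rfl

/-- **Remarque 1, p. 593: `ψ^st(γ) = |W(G,T)|⁻¹ Σ_{w ∈ W(𝐆,T)} ψ(w·γ)`** for `ψ ∈ 𝓘(𝒰)`, `γ ∈ 𝒰_reg`, `𝐓 = 𝐆^γ`, `T = 𝐓 ∩ G` — PRINTED BODY (same data as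
`superstableAverage`). [cite: Bouaziz1994IntegralesOrbitales, Remarque 1 (p. 593)] -/
def stabilise (orb : G → Finset G) (nW : G → ℕ) (ψ : G → ℂ) : G → ℂ :=
  superstableAverage orb nW ψ

/-- `J^st_G(f) = (J_G(f))^st`: display (1) is Remarque 1's stabilisation applied to `J_G(f)` (pp. 591, 593). [cite: Bouaziz1994IntegralesOrbitales, §6.2 (1) (p. 591); Remarque 1 (p. 593)] -/
theorem bouazizJst_eq_stabilise (J : (G → ℂ) → G → ℂ) (orb : G → Finset G) (nW : G → ℕ) (f : G → ℂ) :
    bouazizJst J orb nW f = stabilise orb nW (J f) := rfl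

/-- **§6.2, p. 591: «Alors la fonction `J^st_G(f)` appartient à `𝓘^st(𝒰)`; en effet il est clair qu'elle vérifie `I^st_1(G)`, `I^st_2(G)` et `I^st_4(G)`, pour
`I^st_3(G)` voir [S-1], lemme 4.3.»**  FUNCTION DRESS: `DU` = `𝒟(𝒰)`, `IstU` = `𝓘^st(𝒰)` (predicates on functions, PARAMETERS); the printed inclusion
`J^st_G(𝒟(𝒰)) ⊂ 𝓘^st(𝒰)` as a predicate on the data.  Print asserts it for `G` the real points of a connected reductive group, `𝒰` stably completely invariant
open, the genuine `𝒟`, `𝓘^st`, `J_G`. [cite: Bouaziz1994IntegralesOrbitales, §6.2 (p. 591)] [cite: Shelstad1979, Lemma 4.3 (p. 25)] -/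
def Bouaziz1994_6_2_jst_mem (DU IstU : (G → ℂ) → Prop) (J : (G → ℂ) → G → ℂ) (orb : G → Finset G) (nW : G → ℕ) : Prop :=
  ∀ f : G → ℂ, DU f → IstU (bouazizJst J orb nW f)

/-! ## §2. THÉORÈME 6.2.1 (i) and (iii) (p. 592), function dress -/

/-- **THÉORÈME 6.2.1 (i), p. 592: «L'application `J^st_G : 𝒟(𝒰) → 𝓘^st(𝒰)` est surjective.»**  FUNCTION DRESS: `Ureg` = `𝒰_reg`, `DU` = `𝒟(𝒰)` (the `C^∞`
functions on `G` with compact support in `𝒰`, §3.1), `IstU` = `𝓘^st(𝒰)` (§6.2: `C^∞` on `𝒰_reg`, stably invariant, `I₁`, `I₄`, `I₂^st`, `I₃^st`), `J^st_G` =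
`bouazizJst J orb nW` (display (1)); «surjective» = every `ψ ∈ 𝓘^st(𝒰)` is `J^st_G(f)` ON `𝒰_reg` for some `f ∈ 𝒟(𝒰)`.  A predicate on the data; print asserts it
for `G` the group of real points of a connected reductive algebraic group over `ℝ` (§1.1), `𝒰 ⊂ G` a stably completely invariant open set, the genuine
classes and `J_G`.  This is the statement the tree's consumers use through [Shelstad2012, Cor. 2.2, proof] («Bouaziz's characterization of stable orbital
integrals of `C_c^∞`-functions», schema ★ `Rogawski1990.ArchBouazizReplacement`). [cite: Bouaziz1994IntegralesOrbitales, Théorème 6.2.1 (i) (p. 592)] -/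
def Bouaziz1994_6_2_1_i_surjective (Ureg : Set G) (DU IstU : (G → ℂ) → Prop) (J : (G → ℂ) → G → ℂ) (orb : G → Finset G)
    (nW : G → ℕ) : Prop :=
  ∀ ψ : G → ℂ, IstU ψ → ∃ f : G → ℂ, DU f ∧ ∀ γ ∈ Ureg, bouazizJst J orb nW f γ = ψ γ

variable {ι : Type*} {T : ι → Type*}

/-- **§6.2, p. 591: `Π^st_j(ψ) = Σ_{1≤i≤k} b_{Ψ_i} ψ_{T_i}`**, `Π^st_j : 𝓘^st_j(𝒰) → ⊕_{1≤i≤k} 𝒟(𝒰 ∩ T_i)^{Ψ_i,st}` — PRINTED BODY, componentwise: the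
`i`-th component of `Π^st_j(ψ)` is `b_{Ψ_i}·(ψ restricted to T_i)`.  Data: `ι` indexes the representatives `T_1, …, T_k` of the conjugacy classes in
`Car_j(G)` with their positive imaginary systems `Ψ_i`; `incl i : T i → G` the inclusion of the Cartan subgroup; `b i : T i → ℂ` the function `b_{Ψ_i}`
(§3.2, p. 579: `b_Ψ(h) = Π_{α ∈ Ψ} (1 − ξ_α(h⁻¹))∕|1 − ξ_α(h⁻¹)|` on `H_reg`, extended by a junk value). [cite: Bouaziz1994IntegralesOrbitales, §6.2 (p. 591); §3.2 (p. 579)] -/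
def piSt (incl : (i : ι) → T i → G) (b : (i : ι) → T i → ℂ) (ψ : G → ℂ) (i : ι) : T i → ℂ :=
  fun t => b i t * ψ (incl i t)

/-- **THÉORÈME 6.2.1 (iii), p. 592: «L'application `Π^st_j` est surjective.»**  FUNCTION DRESS: `IstjU` = `𝓘^st_j(𝒰)` (the `ψ ∈ 𝓘^st(𝒰)` with `ψ_T ≡ 0` for
`T ∈ Car_k(G)`, `k > j`), `DPsiSt i` = `𝒟(𝒰 ∩ T_i)^{Ψ_i,st}` (the `f ∈ 𝒟(𝒰 ∩ T_i)` with `(*) f(g⁻¹tg) = ε_I(g) ξ_{ρ_Ψ − g·ρ_Ψ} f(t)`, `t ∈ T_reg`,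
`g ∈ N(𝐆, 𝔱)`, p. 591) — predicates, PARAMETERS; `Ureg` = `𝒰_reg`; `Π^st_j = piSt incl b`.  Every family `(f_i)_i` with `f_i ∈ 𝒟(𝒰 ∩ T_i)^{Ψ_i,st}` is
`Π^st_j(ψ)` ON THE REGULAR POINTS `incl i t ∈ 𝒰_reg` for some `ψ ∈ 𝓘^st_j(𝒰)`.  ED. 2 (TN-plan RULING 2026-09-02T05:04:47Z sustaining T-ref6 «QA-R6-7»): the
equality is asked at the `t ∈ T_i` with `incl i t ∈ 𝒰_reg` only — print's `b_{Ψ_i} ψ_{T_i} ∈ 𝒟(𝒰 ∩ T_i)` (p. 591 «la fonction `b_Ψ ψ_T` appartient à `𝒟(𝒰 ∩ T)`») is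
the smooth extension of a function given on `T_i ∩ 𝒰_reg` (`ψ` lives on `𝒰_reg`, `b_Ψ` on `T_reg`, p. 579), whereas `piSt incl b ψ i` and `b i` carry junk values
at singular `t`, so ED. 1's equality of TOTAL functions on `T i` was stronger than print; same discipline as rows (i) and REM. 1.  A predicate on the data; print
asserts it for every `j ∈ ℕ` and the genuine classes. [cite: Bouaziz1994IntegralesOrbitales, Théorème 6.2.1 (iii) (p. 592); §6.2 (p. 591)] -/
def Bouaziz1994_6_2_1_iii_piSt_surjective (Ureg : Set G) (IstjU : (G → ℂ) → Prop) (DPsiSt : (i : ι) → (T i → ℂ) → Prop)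
    (incl : (i : ι) → T i → G) (b : (i : ι) → T i → ℂ) : Prop :=
  ∀ f : (i : ι) → T i → ℂ, (∀ i, DPsiSt i (f i)) →
    ∃ ψ : G → ℂ, IstjU ψ ∧ ∀ (i : ι) (t : T i), incl i t ∈ Ureg → piSt incl b ψ i t = f i t

/-! ## §3. REMARQUES 1–2 (pp. 593–594), function dress -/

/-- **REMARQUE 1, pp. 593–594**: «Pour `ψ ∈ 𝓘(𝒰)`, on définit la fonction `ψ^st` sur `𝒰_reg` [`stabilise`] … On voit facilement que `ψ^st` appartient à
`𝓘^st(𝒰)` et que l'application `ψ ↦ ψ^st` est continue; la démonstration du théorème montre qu'elle est surjective.»  FUNCTION DRESS: `IU` = `𝓘(𝒰)` (§3.2),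
`IstU` = `𝓘^st(𝒰)`; typed: `ψ^st ∈ 𝓘^st(𝒰)` for `ψ ∈ 𝓘(𝒰)`, and every element of `𝓘^st(𝒰)` is a `ψ^st` on `𝒰_reg` (continuity is NOT typed: the `LF`
topologies of p. 591 are not in the tree).  A predicate on the data. [cite: Bouaziz1994IntegralesOrbitales, Remarque 1 (pp. 593–594)] -/
def Bouaziz1994_6_Rem1_stabilise (Ureg : Set G) (IU IstU : (G → ℂ) → Prop) (orb : G → Finset G) (nW : G → ℕ) : Prop :=
  (∀ ψ : G → ℂ, IU ψ → IstU (stabilise orb nW ψ)) ∧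
    ∀ φ : G → ℂ, IstU φ → ∃ ψ : G → ℂ, IU ψ ∧ ∀ γ ∈ Ureg, stabilise orb nW ψ γ = φ γ

variable {H : Type*}

/-- **REMARQUE 2, p. 594 — transfer of TEST functions**: «Soit `H` le groupe des points réels d'un groupe réductif connexe quasi-déployé `𝐇`. On suppose
que `𝐇` est une forme intérieure de `𝐆`, un groupe endoscopique pour la `L`-indiscernabilité ou un groupe endoscopique pour le changement de base `ℂ∕ℝ`.
Dans les trois situations Shelstad a établi une correspondance `φ → φ_H` de `𝒮(G)` (espace de Harish-Chandra-Schwartz de `G`) dans `𝒮(H)` appelée transfert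
(voir [S-1], [S-2] et [S-3]); avec les arguments de Shelstad, on déduit facilement du théorème 6.2.1 que si `φ ∈ 𝒟(G)`, on peut prendre `φ_H` dans `𝒟(H)`.»
FUNCTION DRESS: `SG`, `SH` = the Schwartz spaces `𝒮(G)`, `𝒮(H)`; `DG`, `DH` = `𝒟(G)`, `𝒟(H)`; `IsTransfer φ φ_H` = «`φ_H` is a transfer of `φ`» (Shelstad's
matching of stable, resp. `κ`-, orbital integrals: [S-1] = ★ `Shelstad1979.StableOrbitalIntegrals.Shelstad1979_4_1_transfer` for inner forms, [S-2] = ★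
`Shelstad1982.TransferAndLifting` for `L`-indistinguishability, [S-3] base change) — all PARAMETERS.  Typed as print argues it: Shelstad's correspondence
on `𝒮(G)` (hypothesis) upgrades, for `φ ∈ 𝒟(G)`, to a transfer `φ_H ∈ 𝒟(H)`.  A predicate on the data; print asserts it in the three situations named.
This is the «`C_c^∞`-transfer» input of [Shelstad2012, Cor. 2.2] and of the tree's schema ★ `Rogawski1990.ArchBouazizReplacement`.
[cite: Bouaziz1994IntegralesOrbitales, Remarque 2 (p. 594)] -/
def Bouaziz1994_6_Rem2_testFunctionTransfer (SG DG : (G → ℂ) → Prop) (SH DH : (H → ℂ) → Prop)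
    (IsTransfer : (G → ℂ) → (H → ℂ) → Prop) : Prop :=
  (∀ φ : G → ℂ, SG φ → ∃ φH : H → ℂ, SH φH ∧ IsTransfer φ φH) →
    ∀ φ : G → ℂ, DG φ → ∃ φH : H → ℂ, DH φH ∧ IsTransfer φ φH

/-- **REMARQUE 2, p. 594 — the «relèvement»**: «Cela induit, par le théorème 3.2.1 et le théorème 6.2.1, une application `Θ ↦ Rel(Θ)`, appelée relèvement, de
l'espace des distributions stablement invariantes sur `H` dans l'espace des distributions invariantes sur `G` de sorte que `Rel(Θ)(φ) = Θ(φ_H)`.»  FUNCTION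
DRESS: distributions as functionals on functions (`(G → ℂ) → ℂ`), the two classes `StabInvH` (stably invariant distributions on `H`) and `InvG` (invariant
distributions on `G`) as predicates, `DG`, `DH`, `IsTransfer` as in `Bouaziz1994_6_Rem2_testFunctionTransfer` — PARAMETERS.  Typed: for every stably
invariant `Θ` on `H` there is an invariant distribution `R = Rel(Θ)` on `G` with `R(φ) = Θ(φ_H)` for every `φ ∈ 𝒟(G)` and EVERY transfer `φ_H ∈ 𝒟(H)` of `φ`
(well-definedness included).  A predicate on the data. [cite: Bouaziz1994IntegralesOrbitales, Remarque 2 (p. 594)] -/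
def Bouaziz1994_6_Rem2_relevement (StabInvH : ((H → ℂ) → ℂ) → Prop) (InvG : ((G → ℂ) → ℂ) → Prop) (DG : (G → ℂ) → Prop)
    (DH : (H → ℂ) → Prop) (IsTransfer : (G → ℂ) → (H → ℂ) → Prop) : Prop :=
  ∀ Θ : (H → ℂ) → ℂ, StabInvH Θ → ∃ R : (G → ℂ) → ℂ, InvG R ∧
    ∀ (φ : G → ℂ) (φH : H → ℂ), DG φ → DH φH → IsTransfer φ φH → R φ = Θ φH

end FunctionDress

/-! ## §4. THÉORÈME 6.2.1 (ii) and (iv) (p. 592): the transposes, dual dress -/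

section DualDress

variable {Γ : Type*} {D I : Type*} [AddCommGroup D] [Module ℂ D] [AddCommGroup I] [Module ℂ I]

/-- **p. 592: «une distribution sur `𝒰` est dite stablement invariante si elle se trouve dans la clôture pour la topologie faible de l'espace vectoriel
engendré par les distributions `f ↦ J^st_G(f)(γ)`, `γ ∈ 𝒰_reg`» ([L, p. 9]).**  DUAL DRESS: `D` = `𝒟(𝒰)` and `I` = `𝓘^st(𝒰)` as `ℂ`-modules, `J : D →ₗ I` =
`J^st_G`, `ev γ : I →ₗ ℂ` = evaluation at `γ ∈ 𝒰_reg` (`Γ` = `𝒰_reg`); a functional `Θ` on `𝒟(𝒰)` is stably invariant iff it lies in the closure, for the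
topology of pointwise convergence on `D` (= «topologie faible» `σ(𝒟′, 𝒟)`), of the span of the `f ↦ J^st_G(f)(γ) = (ev γ ∘ J)(f)`.  (That `Θ` be a
DISTRIBUTION — continuous — is the separate condition `Θ ∈ Dc` in `Bouaziz1994_6_2_1_ii_transpose`.)
[cite: Bouaziz1994IntegralesOrbitales, §6.2 (p. 592)] -/
def IsStablyInvariantDistribution (J : D →ₗ[ℂ] I) (ev : Γ → Module.Dual ℂ I) (Θ : Module.Dual ℂ D) : Prop :=
  (⇑Θ : D → ℂ) ∈ closure ((fun Θ' : Module.Dual ℂ D => (⇑Θ' : D → ℂ)) ''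
    (Submodule.span ℂ (Set.range fun γ : Γ => (ev γ).comp J) : Set (Module.Dual ℂ D)))

/-- **THÉORÈME 6.2.1 (ii), p. 592: «Sa transposée `ᵗJ^st_G` est une bijection de `𝓘^st(𝒰)′` sur l'espace des distributions stablement invariantes sur `𝒰`.»**
DUAL DRESS: `Dc ≤ Module.Dual ℂ D` = `𝒟(𝒰)′` (the distributions on `𝒰` = CONTINUOUS functionals for the `LF` topology, p. 591) and `Ic ≤ Module.Dual ℂ I` =
`𝓘^st(𝒰)′` — PARAMETERS (the topologies are not typed); `ᵗJ^st_G(θ) = θ ∘ J^st_G`; typed: `θ ↦ θ ∘ J` maps `𝓘^st(𝒰)′` bijectively onto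
`{Θ ∈ 𝒟(𝒰)′ : Θ stably invariant}`.  A predicate on the data; print asserts it for the genuine `LF` duals.
[cite: Bouaziz1994IntegralesOrbitales, Théorème 6.2.1 (ii) (p. 592)] -/
def Bouaziz1994_6_2_1_ii_transpose (Dc : Submodule ℂ (Module.Dual ℂ D)) (Ic : Submodule ℂ (Module.Dual ℂ I)) (J : D →ₗ[ℂ] I)
    (ev : Γ → Module.Dual ℂ I) : Prop :=
  Set.BijOn (fun θ : Module.Dual ℂ I => θ.comp J) (Ic : Set (Module.Dual ℂ I))
    {Θ : Module.Dual ℂ D | Θ ∈ Dc ∧ IsStablyInvariantDistribution J ev Θ}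

variable {Ij E : Type*} [AddCommGroup Ij] [Module ℂ Ij] [AddCommGroup E] [Module ℂ E]

/-- **THÉORÈME 6.2.1 (iv), p. 592: «Sa transposée `ᵗΠ^st_j` est une bijection de `(⊕_{1≤i≤k} 𝒟(𝒰 ∩ T_i)^{Ψ_i,st})′` sur l'orthogonal de `𝓘^st_{j−1}(𝒰)` dans
`(𝓘^st_j(𝒰))′`.»**  DUAL DRESS: `Ij` = `𝓘^st_j(𝒰)` with the submodule `Ijm1` = `𝓘^st_{j−1}(𝒰)`, `E` = `⊕_i 𝒟(𝒰 ∩ T_i)^{Ψ_i,st}`, `P : Ij →ₗ E` = `Π^st_j`,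
`Ijc`, `Ec` the continuous duals (PARAMETERS); typed: `θ ↦ θ ∘ Π^st_j` maps `E′` bijectively onto `{Θ ∈ 𝓘^st_j(𝒰)′ : Θ|_{𝓘^st_{j−1}(𝒰)} = 0}`.  A predicate on the
data. [cite: Bouaziz1994IntegralesOrbitales, Théorème 6.2.1 (iv) (p. 592)] -/
def Bouaziz1994_6_2_1_iv_transpose (Ijc : Submodule ℂ (Module.Dual ℂ Ij)) (Ec : Submodule ℂ (Module.Dual ℂ E)) (P : Ij →ₗ[ℂ] E)
    (Ijm1 : Submodule ℂ Ij) : Prop :=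
  Set.BijOn (fun θ : Module.Dual ℂ E => θ.comp P) (Ec : Set (Module.Dual ℂ E))
    {Θ : Module.Dual ℂ Ij | Θ ∈ Ijc ∧ ∀ ψ ∈ Ijm1, Θ ψ = 0}

end DualDress

end Literature.RepresentationTheory.Bouaziz1994.OrbitalIntegralsCharacterisation

end
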